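import Literature.Computability.Cryptography.VanDamSeroussiOracleBQP
import Literature.Computability.Complexity.AdaptiveFunctions
import Literature.Computability.Complexity.OracleClosure
import Literature.Computability.Complexity.FoldBricks
import HarnessLib

/-!
# The prime factorisation as a polynomial-time function relative to the factor-bit language

Topic `Literature/Computability/Cryptography` (next to `VanDamSeroussiOracleBQP.lean`, whose certificate
code `VDSOracle.certCode = listE bin` and parser `VDSOracle.parseF` are reused). The **factor-bit language**

  `FB = {⟨bin N, u⟩ : bit |u| of code(primeFactorsList N) is 1}`

(index in unary = the LENGTH of the second component; in `BQP` by Shor's theorem, one classical wrap and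
decision from search — a landed summit-side theorem, not needed here) answers the prime factorisation of
`N` bit by bit. This file proves that **the whole factor list is an `FP^{FB}` function**:
`FactorBits.exists_factorList_mem_FPRel` — there is `T ∈ FPRel (Oracle.ofLanguage FB)` with
`T x = code(primeFactorsList ⟦x⟧)` on EVERY string `x` (`⟦x⟧ = decodeNat x`; the queries re-encode `x`
canonically). The machine is the adaptive oracle transducer `AdQuery.adFn Q p G` (Ladner–Lynch–Selman
1975, §2; `AdaptiveFunctions.lean`): query generator `Q ⟨x, answers⟩ = ⟨canon x, answers⟩` (so query `i`
has a second component of length `i` and is answered by bit `i` of the code), `p = 2(X+2)²` rounds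
(`length_certCode_le`: the code of the factor list of `⟦x⟧` has at most `2(|x|+2)²` bits), output map
`G ⟨x, bits⟩ = certCode (parseF bits)` (the list code is self-delimiting, `VDSOracle.parseF_certCode_append`).
Consumers compose `T` with `FP` maps on both sides (`postPre_mem_FPRel`), e.g. the pre-processing
"factor the input, then compute the instance data" of Hallgren-type algorithms (Hallgren 2005, §1)
inside `OracleWrap.isQSolvable_of_uniform` (`QuantumComplexity/OraclePreprocessWrap.lean`).
Theorem-only file.

## References

* R. E. Ladner, N. A. Lynch, A. L. Selman, *A comparison of polynomial time reducibilities*, Theoret.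
  Comput. Sci. 1 (1975), §2 [LadnerLynchSelman1975].
* S. Arora, B. Barak, *Computational Complexity: A Modern Approach*, CUP 2009, §17.2.1 (bit-by-bit
  search with an oracle) [AroraBarak2009].
* S. Hallgren, STOC 2005, §1 [Hallgren2005].
-/

noncomputable section

namespace Literature.Computability.Cryptography

namespace FactorBits

open _root_.Computability Complexity Complexity.Brick Complexity.CodeFP Complexity.AdQuery Polynomial
open VDSOracle (certCode parseF parseF_certCode_append encode_primeFactorsList_eq codeFP_parseF)

/-! ### The language and its answers -/

/-- **Membership of a canonical query in the factor-bit language**: `⟨bin N, u⟩ ∈ FB` iff bit `|u|` of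
`code(primeFactorsList N)` is `1` (pairing and canonical numerals are injective). [folklore] -/
theorem boolPair_encodeNat_mem_iff (N : ℕ) (u : List Bool) :
    boolPair (encodeNat N) u ∈ {w : List Bool | ∃ (N : ℕ) (u : List Bool), w = boolPair (encodeNat N) u ∧
        (encodingListNatBool.encode (Nat.primeFactorsList N)).getD u.length false = true} ↔
      (certCode N.primeFactorsList).getD u.length false = true := by
  simp only [encode_primeFactorsList_eq, Set.mem_setOf_eq]
  constructor
  · rintro ⟨N', u', h, hbit⟩
    obtain ⟨hN, rfl⟩ := QuantumComplexity.boolPair_inj.1 h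
    rw [natE_injective hN]
    exact hbit
  · exact fun h => ⟨N, u, rfl, h⟩

/-- **The code of the factor list is short**: `|code(primeFactorsList ⟦x⟧)| ≤ 2(|x|+2)²` — at most
`|bin m|` prime factors of at most `|bin m|` bits each, and `|bin ⟦x⟧| ≤ |x| + 1`. [folklore] -/
theorem length_certCode_le (x : List Bool) :
    (certCode (decodeNat x).primeFactorsList).length ≤ (2 * (X + 2) ^ 2 : Polynomial ℕ).eval x.length := by
  set n := decodeNat x with hn
  have hm : (encodeNat n).length ≤ x.length + 1 := by
    rw [hn, ← canonF_eq_encodeNat_decodeNat]; exact length_canonF_le x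
  have hsz : (encodeNat n).length = n.size := TM2Pass.length_encodeNat_eq_size n
  have hF : n.primeFactorsList.length ≤ (encodeNat n).length := by
    rcases Nat.eq_zero_or_pos n with h0 | h0
    · rw [h0]; simp
    · have h1 := List.pow_card_le_prod n.primeFactorsList 2 fun q hq =>
        (Nat.prime_of_mem_primeFactorsList hq).two_le
      rw [Nat.prod_primeFactorsList h0.ne'] at h1
      have h2 : n < 2 ^ n.size := Nat.lt_size_self n
      have h3 := (Nat.pow_lt_pow_iff_right (by norm_num : 1 < 2)).1 (h1.trans_lt h2)
      omega
  have hitem : ∀ a ∈ n.primeFactorsList, 2 * (natE a).length + 2 ≤ 2 * (encodeNat n).length + 2 := by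
    intro a ha
    have : (natE a).length ≤ (encodeNat n).length := by
      rw [show natE a = encodeNat a from rfl, TM2Pass.length_encodeNat_eq_size, hsz]
      exact Nat.size_le_size (Nat.le_of_mem_primeFactorsList ha)
    omega
  have hsum := List.sum_le_card_nsmul _ _ fun b hb => by
    obtain ⟨a, ha, rfl⟩ := List.mem_map.1 hb
    exact hitem a ha
  rw [List.length_map, smul_eq_mul] at hsum
  rw [certCode, listE, length_boolPair, length_unE, length_rawE]
  have hk : n.primeFactorsList.length * (2 * (encodeNat n).length + 2) ≤
      (encodeNat n).length * (2 * (encodeNat n).length + 2) := Nat.mul_le_mul_right _ hF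
  have heval : (2 * (X + 2) ^ 2 : Polynomial ℕ).eval x.length = 2 * (x.length + 2) ^ 2 := by
    simp [eval_pow]
  rw [heval]
  nlinarith [hsum, hk, hm, hF]

/-! ### The transducer -/

section Transducer

variable {G : List Bool → List Bool}

/-- **The answer bits are the bits of the code**: against `FB`, with the queries
`⟨canon x, answers so far⟩`, the `i`-th answer string is the `i`-prefix of the zero-padded code of the
factor list of `⟦x⟧`, for `i` up to the padded length. [cite: AroraBarak2009, §17.2.1] -/
theorem adBits_eq_take (x : List Bool) (P : ℕ)
    (hP : (certCode (decodeNat x).primeFactorsList).length ≤ P) :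
    ∀ i ≤ P, adBits (fanoutFn (canonF ∘ fstF) sndF)
        {w : List Bool | ∃ (N : ℕ) (u : List Bool), w = boolPair (encodeNat N) u ∧
          (encodingListNatBool.encode (Nat.primeFactorsList N)).getD u.length false = true} x i =
      (certCode (decodeNat x).primeFactorsList ++
        List.replicate (P - (certCode (decodeNat x).primeFactorsList).length) false).take i
  | 0, _ => by simp
  | i + 1, hi => by
    set c := certCode (decodeNat x).primeFactorsList with hc
    have hW : (c ++ List.replicate (P - c.length) false).length = P := by
      rw [List.length_append, List.length_replicate]; omega
    have hiW : i < (c ++ List.replicate (P - c.length) false).length := by rw [hW]; exact hi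
    rw [adBits_succ, adBits_eq_take x P hP i (Nat.le_of_succ_le hi), fanoutFn_apply, Function.comp_apply,
      fstF_boolPair, sndF_boolPair, canonF_eq_encodeNat_decodeNat, List.take_add_one,
      List.getElem?_eq_getElem hiW]
    congr 1
    -- the answer to query `i` is bit `i` of the padded code
    have hlen : ((c ++ List.replicate (P - c.length) false).take i).length = i :=
      List.length_take_of_le (by omega)
    have hbit : (c ++ List.replicate (P - c.length) false)[i]'hiW = c.getD i false := by
      rw [List.getD_eq_getElem?_getD]
      by_cases h : i < c.length
      · rw [List.getElem_append_left h, List.getElem?_eq_getElem h, Option.getD_some]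
      · rw [List.getElem_append_right (not_lt.1 h), List.getElem_replicate,
          List.getElem?_eq_none (not_lt.1 h), Option.getD_none]
    rw [hbit]
    cases hb : c.getD i false
    · refine congrArg (fun b => [b]) ((Set.notMem_iff_boolIndicator _ _).1 fun hm => ?_)
      have h1 := (boolPair_encodeNat_mem_iff (decodeNat x) _).1 hm
      rw [hlen, ← hc, hb] at h1
      exact Bool.false_ne_true h1
    · exact congrArg (fun b => [b]) ((Set.mem_iff_boolIndicator _ _).1
        ((boolPair_encodeNat_mem_iff (decodeNat x) _).2 (by rw [hlen, ← hc, hb])))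

end Transducer

/-- **The prime factorisation is an `FP^{FB}` function.** There is a string function `T`,
polynomial-time relative to the factor-bit language, with `T x = code(primeFactorsList ⟦x⟧)`
(`encodingListNatBool.encode`, i.e. `listE bin`) for EVERY string `x`: the adaptive transducer with
queries `⟨canon x, answers⟩`, `2(|x|+2)²` rounds, and output `certCode (parseF answers)`.
[cite: LadnerLynchSelman1975, §2 (polynomial-time Turing reductions: adaptive oracle machines)] -/
theorem exists_factorList_mem_FPRel :
    ∃ T : List Bool → List Bool,
      T ∈ FPRel (Oracle.ofLanguage {w : List Bool | ∃ (N : ℕ) (u : List Bool),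
        w = boolPair (encodeNat N) u ∧
          (encodingListNatBool.encode (Nat.primeFactorsList N)).getD u.length false = true}) ∧
      ∀ x : List Bool, T x = encodingListNatBool.encode (decodeNat x).primeFactorsList := by
  -- the output map `⟨x, bits⟩ ↦ certCode (parseF bits)`
  have hcode : CodeFP (rawE natE) strE certCode := (listOfRaw natE).recodeOut fun _ => rfl
  have hsnd : CodeFP strE strE sndF := ⟨sndF, sndF_mem_FP, fun _ => rfl⟩
  obtain ⟨G, hG, hGval⟩ := hcode.comp (codeFP_parseF.comp hsnd)
  have hGv : ∀ x bits : List Bool, G (boolPair x bits) = certCode (parseF bits) := fun x bits => by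
    have h := hGval (boolPair x bits)
    simp only [strE, id, sndF_boolPair] at h
    exact h
  have hQ : fanoutFn (canonF ∘ fstF) sndF ∈ FP :=
    fanoutFn_mem_FP (comp_mem_FP canonF_mem_FP fstF_mem_FP) sndF_mem_FP
  refine ⟨adFn (fanoutFn (canonF ∘ fstF) sndF) (2 * (X + 2) ^ 2) G _, adFn_mem_FPRel hQ hG _, fun x => ?_⟩
  have hP := length_certCode_le x
  set c := certCode (decodeNat x).primeFactorsList with hc
  have hW : (c ++ List.replicate ((2 * (X + 2) ^ 2 : Polynomial ℕ).eval x.length - c.length)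
      false).length =
      (2 * (X + 2) ^ 2 : Polynomial ℕ).eval x.length := by
    rw [List.length_append, List.length_replicate]; omega
  rw [adFn_apply, adBits_eq_take x _ hP _ le_rfl, List.take_of_length_le hW.le, hGv, hc,
    parseF_certCode_append, encode_primeFactorsList_eq]

end FactorBits

end Literature.Computability.Cryptography

end
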